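import Summits.NavierStokesRegularity.FunctionalMining.RateBudgets
import Summits.NavierStokesRegularity.FunctionalMining.StretchingConst
import Literature.Analysis.FunctionSpaces.TorusPlanarLift
import Literature.Analysis.FunctionSpaces.TorusSpaceTime
import Literature.Analysis.FluidPDE.DEIJShearStage
import Literature.Analysis.FluidPDE.ShearStageTransport
import HarnessLib

/-!
# K1-Q1 lower side in the kernel: sheared-wave ("composition") fields (part 1: calculus)

Cell `pub-nsfunc` (host summit NavierStokesRegularity, topic `FunctionalMining`), prove seat gen 4, on the
bank seat's `pub-nsfunc-bank/K1Q1-PRESSURELESS.md` (2026-08-20). **Search for candidate a priori estimates;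
no regularity claim.** Static field facts only; nothing is asserted about Navier–Stokes.

For smooth `1`-periodic profiles `g, T` (`Torus.ShearProfile`) and `c ∈ ℝ` the *composition field*
`u(x) = (0, −c·g(x₀), T(x₁ + g(x₀)))` on the unit `T³` is the `2½`-dimensional lift (`Torus.twoHalf`) of
the planar shear drift `V = (0, −c g(y₀))` (`ShearStage.drift`) and the sheared scalar
`R = T(y₁) ∘ Φ`, `Φ(y) = y + g(y₀)e₁` (`Torus.shearMap 1 0 g.neg`). It is smooth and divergence free, and
(this file, with `g' = deriv g`, `T' = deriv T`, `ξ = y₁ + g(y₀)`):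
* `∂₀u = (0, −c g'(y₀), g'(y₀)T'(ξ))`, `∂₁u = (0, 0, T'(ξ))`, `∂₂u = 0`; hence
  `|ω(x)|² = c²g'(y₀)² + (1 + g'(y₀)²)·T'(ξ)²` (`torusVorticitySqAt_u`);
* `ΔR = g''(y₀)T'(ξ) + (1 + g'(y₀)²)T''(ξ)`, `(u·∇)u = (0, 0, −c g(y₀)T'(ξ))`, so the production
  integrand is `⟪(u·∇)u, Δu⟫ = −c g T'(ξ)·(g''T'(ξ) + (1+g'²)T''(ξ))` (`inner_convect_laplacian_u`);
* `∑ᵢ‖∂ᵢu‖² = c²g'² + (1+g'²)T'(ξ)²` (`sum_norm_sq_partialDeriv_u`).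
Part 2 (`StretchingLowerShearKill`) integrates (shear change of variables + Fubini on `T²`, periodic
integration by parts): production `cγτ`, enstrophy `(τ(1+γ) + c²γ)/2` (`γ = ∫₀¹g'²`, `τ = ∫₀¹T'²`), and
derives `¬ StretchingSupBound C` for `C < 2cγτ/(√(c²G²+(1+G²)Θ²)·(τ(1+γ)+c²γ))` and, along the tree's
smoothed sawtooth profiles (`DEIJ.stageProfile`), **`2√3/9 ≤ C⋆`**.
-/

noncomputable section

open MeasureTheory Set Filter Topology Function UnitAddTorus
open scoped InnerProductSpace ContDiff

namespace Summit.NavierStokesRegularity.FunctionalMining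

open Literature.Analysis Literature.Analysis.FunctionSpaces Literature.Analysis.FunctionSpaces.Torus
open Literature.Analysis.FluidPDE Literature.Analysis.FluidPDE.Torus

namespace ShearComposition

local notation "𝕋³" => UnitAddTorus (Fin 3)
local notation "𝕋²" => UnitAddTorus (Fin 2)
local notation "E³" => EuclideanSpace ℝ (Fin 3)
local notation "E²" => EuclideanSpace ℝ (Fin 2)

/-! ## 1. Functions of one coordinate on `T²` -/

/-- Values of the derivative profile on the circle: `φ'.onCircle ↑t = deriv φ t`. [folklore] -/
theorem D_onCircle_coe (P : ShearProfile) (t : ℝ) : P.D.onCircle (t : UnitAddCircle) = deriv P t := by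
  rw [ShearProfile.onCircle_coe]; rfl

/-- The derivative profile of `−φ` is `−φ'` (on the circle). [folklore] -/
theorem neg_D_onCircle (P : ShearProfile) (b : UnitAddCircle) : P.neg.D.onCircle b = -P.D.onCircle b := by
  obtain ⟨t, rfl⟩ := QuotientAddGroup.mk_surjective b
  rw [D_onCircle_coe, D_onCircle_coe]
  change deriv (fun s => -P s) t = -deriv P t
  exact deriv.neg

/-- A uniform bound on `deriv φ` bounds the derivative profile on the circle. [folklore] -/
theorem abs_D_onCircle_le {P : ShearProfile} {M : ℝ} (hM : ∀ t, |deriv P t| ≤ M) (b : UnitAddCircle) :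
    |P.D.onCircle b| ≤ M := by
  obtain ⟨t, rfl⟩ := QuotientAddGroup.mk_surjective b
  rw [D_onCircle_coe]; exact hM t

/-- **Partial derivatives of a function of one coordinate**: for `f(y) = φ(y_j)`,
`∂_r f(y) = φ'(y_j)` if `r = j` and `0` otherwise. [folklore] -/
theorem partialDeriv_onCircle_comp (P : ShearProfile) (j r : Fin 2) (y : 𝕋²) :
    Torus.partialDeriv r (fun y : 𝕋² => P.onCircle (y j)) y =
      if r = j then P.D.onCircle (y j) else 0 := by
  obtain ⟨z, rfl⟩ := proj_surjective y
  unfold Torus.partialDeriv Torus.lineDeriv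
  have harg : ∀ t : ℝ, (proj z + proj (t • EuclideanSpace.single r (1 : ℝ))) j =
      ((z j + t * (if j = r then 1 else 0) : ℝ) : UnitAddCircle) := by
    intro t
    rw [Pi.add_apply, proj_apply, proj_apply, ← AddCircle.coe_add]
    congr 1
    by_cases h : j = r
    · subst h; simp
    · simp [h]
  simp_rw [harg, ShearProfile.onCircle_coe]
  by_cases h : r = j
  · subst h
    simp only [if_true, mul_one, proj_apply, D_onCircle_coe]
    have hd : HasDerivAt (fun t : ℝ => P (z r + t)) (deriv P (z r)) 0 := by
      have h1 : HasDerivAt P (deriv P (z r)) (z r + 0) := by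
        rw [add_zero]; exact ((P.contDiff.differentiable (by simp)) _).hasDerivAt
      exact HasDerivAt.comp_const_add (z r) 0 h1
    exact hd.deriv
  · have h' : ¬ j = r := fun e => h e.symm
    simp only [h, h', if_false, mul_zero, add_zero, deriv_const]

/-- The function `y ↦ φ(y_j)` is `C¹` on `T²`. [folklore] -/
theorem isContDiff_onCircle_comp (P : ShearProfile) (j : Fin 2) :
    IsContDiff 1 (fun y : 𝕋² => P.onCircle (y j)) :=
  (ShearStage.isSmooth_onCircle_comp j P).isContDiff (by simp)

/-! ## 2. The sheared scalar `R(y) = T(y₁ + g(y₀))` and its derivatives -/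

variable (g T : ShearProfile) (c : ℝ)

/-- The shear `Φ(y) = y + g(y₀) e₁` of `T²` (the tree's `shearMap 1 0` driven by `−g`). [ours; bookkeeping] -/
def Φ (g : ShearProfile) : 𝕋² → 𝕋² := shearMap (1 : Fin 2) 0 g.neg

/-- The unsheared scalar `θ(y) = T(y₁)`. [ours; bookkeeping] -/
def θ (T : ShearProfile) : 𝕋² → ℝ := fun y => T.onCircle (y 1)

/-- **The sheared scalar** `R(y) = T(y₁ + g(y₀)) = (θ ∘ Φ)(y)`. [ours] -/
def R (g T : ShearProfile) : 𝕋² → ℝ := θ T ∘ Φ g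

/-- **The planar drift** `V(y) = (0, −c g(y₀))`. [ours] -/
def V (g : ShearProfile) (c : ℝ) : 𝕋² → E² := ShearStage.drift 1 0 g (-c)

/-- **The composition field** `u = (0, −c g(x₀), T(x₁ + g(x₀)))` on `T³`. [ours] -/
def u (g T : ShearProfile) (c : ℝ) : 𝕋³ → E³ := twoHalf (V g c) (R g T)

/-- The shear fixes the driving coordinate: `(Φ y)₀ = y₀`. [folklore] -/
theorem Φ_apply_zero (y : 𝕋²) : Φ g y 0 = y 0 :=
  shearMap_apply_of_ne g.neg y (by decide)

/-- `θ` is smooth. [folklore] -/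
theorem isSmooth_θ : IsSmooth (θ T) := ShearStage.isSmooth_onCircle_comp 1 T

/-- `R` is smooth. [folklore] -/
theorem isSmooth_R : IsSmooth (R g T) := (isSmooth_θ T).comp_shearMap 1 0 g.neg

/-- `V` is smooth. [folklore] -/
theorem isSmooth_V : IsSmooth (V g c) := ShearStage.isSmooth_drift 1 0 g (-c)

/-- **`u` is smooth.** [ours] -/
theorem isSmooth_u : IsSmooth (u g T c) := (isSmooth_V g c).twoHalf (isSmooth_R g T)

/-- **`u` is divergence free** (`V` is, and the third component does not depend on `x₂`). [ours] -/
theorem isDivFree_u : IsDivFree (u g T c) :=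
  (ShearStage.isDivFree_drift (by decide) g (-c)).twoHalf (R g T)

/-- The abbreviations `g'(y₀)`, `T'(ξ)`, `T''(ξ)` (`ξ = (Φy)₁ = y₁ + g(y₀)`). [ours; bookkeeping] -/
def gp (y : 𝕋²) : ℝ := g.D.onCircle (y 0)
/-- `g''(y₀)`. [ours; bookkeeping] -/
def gpp (y : 𝕋²) : ℝ := g.D.D.onCircle (y 0)
/-- `T'(ξ)`, `ξ = y₁ + g(y₀)`. [ours; bookkeeping] -/
def Tp (y : 𝕋²) : ℝ := T.D.onCircle (Φ g y 1)
/-- `T''(ξ)`. [ours; bookkeeping] -/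
def Tpp (y : 𝕋²) : ℝ := T.D.D.onCircle (Φ g y 1)

/-- `∂₁θ = T'(y₁)`, `∂₀θ = 0`. [folklore] -/
theorem partialDeriv_θ (r : Fin 2) :
    Torus.partialDeriv r (θ T) = fun y => if r = 1 then T.D.onCircle (y 1) else 0 := by
  funext y; exact partialDeriv_onCircle_comp T 1 r y

/-- **`∂₁R(y) = T'(ξ)`.** [ours; elementary] -/
theorem partialDeriv_one_R (y : 𝕋²) : Torus.partialDeriv 1 (R g T) y = Tp g T y := by
  rw [R, Φ, DEIJ.partialDeriv_comp_shearMap_of_ne (isSmooth_θ T) g.neg (by decide), partialDeriv_θ]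
  simp [Tp, Φ]

/-- **`∂₀R(y) = g'(y₀)·T'(ξ)`.** [ours; elementary] -/
theorem partialDeriv_zero_R (y : 𝕋²) : Torus.partialDeriv 0 (R g T) y = gp g y * Tp g T y := by
  rw [R, Φ, DEIJ.partialDeriv_comp_shearMap_same (isSmooth_θ T) g.neg, partialDeriv_θ, partialDeriv_θ,
    neg_D_onCircle]
  simp [gp, Tp, Φ]

/-- `∂₁R = (∂₁θ) ∘ Φ` as functions. [ours; bookkeeping] -/
theorem partialDeriv_one_R_eq : Torus.partialDeriv 1 (R g T) = Torus.partialDeriv 1 (θ T) ∘ Φ g := by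
  funext y
  rw [partialDeriv_one_R, Function.comp_apply, partialDeriv_θ]
  simp [Tp]

/-- **`∂₁∂₁R(y) = T''(ξ)`.** [ours; elementary] -/
theorem partialDeriv_one_one_R (y : 𝕋²) :
    Torus.partialDeriv 1 (Torus.partialDeriv 1 (R g T)) y = Tpp g T y := by
  rw [partialDeriv_one_R_eq, Φ,
    DEIJ.partialDeriv_comp_shearMap_of_ne ((isSmooth_θ T).partialDeriv 1) g.neg (by decide), partialDeriv_θ]
  simp only [if_true]
  rw [partialDeriv_onCircle_comp T.D 1 1]
  simp [Tpp, Φ]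

/-- `∂₀((∂₁θ) ∘ Φ)(y) = g'(y₀) T''(ξ)`. [ours; elementary] -/
theorem partialDeriv_zero_comp (y : 𝕋²) :
    Torus.partialDeriv 0 (Torus.partialDeriv 1 (θ T) ∘ Φ g) y = gp g y * Tpp g T y := by
  rw [Φ, DEIJ.partialDeriv_comp_shearMap_same ((isSmooth_θ T).partialDeriv 1) g.neg, partialDeriv_θ,
    neg_D_onCircle]
  simp only [if_true]
  rw [partialDeriv_onCircle_comp T.D 1 0, partialDeriv_onCircle_comp T.D 1 1]
  simp [gp, Tpp, Φ]

/-- **`∂₀∂₀R(y) = g''(y₀)T'(ξ) + g'(y₀)²T''(ξ)`.** [ours; elementary] -/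
theorem partialDeriv_zero_zero_R (y : 𝕋²) :
    Torus.partialDeriv 0 (Torus.partialDeriv 0 (R g T)) y = gpp g y * Tp g T y + gp g y ^ 2 * Tpp g T y := by
  have hfun : Torus.partialDeriv 0 (R g T) = fun y => g.D.onCircle (y 0) * (Torus.partialDeriv 1 (θ T) ∘ Φ g) y := by
    funext y
    rw [partialDeriv_zero_R, Function.comp_apply, partialDeriv_θ]
    simp [gp, Tp]
  have hb : IsContDiff 1 (Torus.partialDeriv 1 (θ T) ∘ Φ g) :=
    (((isSmooth_θ T).partialDeriv 1).comp_shearMap 1 0 g.neg).isContDiff (by simp)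
  rw [hfun, partialDeriv_mul (isContDiff_onCircle_comp g.D 0) hb, partialDeriv_zero_comp,
    partialDeriv_onCircle_comp g.D 0 0]
  simp only [if_true, Function.comp_apply, partialDeriv_θ]
  simp [gp, gpp, Tp, Tpp]
  ring

/-- **`ΔR(y) = g''(y₀)T'(ξ) + (1 + g'(y₀)²)T''(ξ)`.** [ours; elementary] -/
theorem laplacian_R (y : 𝕋²) :
    Torus.laplacian (R g T) y = gpp g y * Tp g T y + (1 + gp g y ^ 2) * Tpp g T y := by
  rw [laplacian_eq_sum_partialDeriv_partialDeriv (isSmooth_R g T), Fin.sum_univ_two,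
    partialDeriv_zero_zero_R, partialDeriv_one_one_R]
  ring

/-! ## 3. The drift `V(y) = (0, −c g(y₀))` -/

/-- Values of `V`. [ours; bookkeeping] -/
theorem V_apply (y : 𝕋²) : V g c y = (-c * g.onCircle (y 0)) • EuclideanSpace.single 1 (1 : ℝ) := rfl

/-- **`∂₀V(y) = (0, −c g'(y₀))`, `∂₁V = 0`.** [ours; elementary] -/
theorem partialDeriv_V (r : Fin 2) (y : 𝕋²) :
    Torus.partialDeriv r (V g c) y =
      (if r = 0 then -c * gp g y else 0) • EuclideanSpace.single 1 (1 : ℝ) := by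
  have ha : IsContDiff 1 (fun y : 𝕋² => -c * g.onCircle (y 0)) :=
    ((ShearStage.isSmooth_onCircle_comp 0 g).smul (-c)).isContDiff (by simp)
  have hfun : V g c = fun y => (-c * g.onCircle (y 0)) • (fun _ : 𝕋² => EuclideanSpace.single (1 : Fin 2) (1 : ℝ)) y :=
    rfl
  rw [hfun, partialDeriv_smul ha (isContDiff_const _)]
  have h0 : Torus.partialDeriv r (fun _ : 𝕋² => EuclideanSpace.single (1 : Fin 2) (1 : ℝ)) y = 0 := by
    unfold Torus.partialDeriv Torus.lineDeriv; simp
  have h1 : Torus.partialDeriv r (fun y : 𝕋² => -c * g.onCircle (y 0)) y =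
      -c * Torus.partialDeriv r (fun y : 𝕋² => g.onCircle (y 0)) y := by
    have e : (fun y : 𝕋² => -c * g.onCircle (y 0)) = fun y => (-c) • (fun y : 𝕋² => g.onCircle (y 0)) y := rfl
    rw [e, partialDeriv_smul (isContDiff_const _) (isContDiff_onCircle_comp g 0)]
    have : Torus.partialDeriv r (fun _ : 𝕋² => -c) y = 0 := by
      unfold Torus.partialDeriv Torus.lineDeriv; simp
    rw [this]; simp
  rw [h0, h1, partialDeriv_onCircle_comp g 0 r]
  by_cases hr : r = 0
  · subst hr; simp [gp]
  · simp [hr]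

/-- `(V·∇)V = 0` (the drift is a pressureless steady Euler flow). [folklore] -/
theorem convect_V : Torus.convect (V g c) (V g c) = 0 := by
  funext y; exact ShearStage.convect_drift_self (by decide) g (-c) (-c) y

/-- `⟪V, ∇R⟫(y) = −c g(y₀) T'(ξ)`. [ours; elementary] -/
theorem inner_V_gradient_R (y : 𝕋²) :
    ⟪V g c y, Torus.gradient (R g T) y⟫_ℝ = -c * g.onCircle (y 0) * Tp g T y := by
  rw [V_apply, real_inner_smul_left, EuclideanSpace.inner_single_left,
    gradient_eq_sum_partialDeriv ((isSmooth_R g T).isContDiff (by simp))]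
  simp [Fin.sum_univ_two, partialDeriv_one_R]

/-! ## 4. The composition field on `T³`: first derivatives, vorticity, production integrand -/

/-- `C¹` bookkeeping. [folklore] -/
theorem isContDiff_V : IsContDiff 1 (V g c) := (isSmooth_V g c).isContDiff (by simp)
/-- `C¹` bookkeeping. [folklore] -/
theorem isContDiff_R : IsContDiff 1 (R g T) := (isSmooth_R g T).isContDiff (by simp)

/-- **`∂₀u = (0, −c g'(y₀), g'(y₀)T'(ξ))`** at `y = πx`. [ours; elementary] -/
theorem partialDeriv_zero_u (x : 𝕋³) :
    Torus.partialDeriv 0 (u g T c) x 0 = 0 ∧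
    Torus.partialDeriv 0 (u g T c) x 1 = -c * gp g (planarProj x) ∧
    Torus.partialDeriv 0 (u g T c) x 2 = gp g (planarProj x) * Tp g T (planarProj x) := by
  have h := partialDeriv_twoHalf_castSucc (isContDiff_V g c) (isContDiff_R g T) 0
  rw [show (Fin.castSucc (0 : Fin 2) : Fin 3) = 0 from rfl] at h
  rw [u, h]
  refine ⟨?_, ?_, ?_⟩
  · rw [show (0 : Fin 3) = Fin.castSucc (0 : Fin 2) from rfl, twoHalf_apply_castSucc, partialDeriv_V]
    simp
  · rw [show (1 : Fin 3) = Fin.castSucc (1 : Fin 2) from rfl, twoHalf_apply_castSucc, partialDeriv_V]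
    simp
  · rw [twoHalf_apply_two, partialDeriv_zero_R]

/-- **`∂₁u = (0, 0, T'(ξ))`** at `y = πx`. [ours; elementary] -/
theorem partialDeriv_one_u (x : 𝕋³) :
    Torus.partialDeriv 1 (u g T c) x 0 = 0 ∧ Torus.partialDeriv 1 (u g T c) x 1 = 0 ∧
    Torus.partialDeriv 1 (u g T c) x 2 = Tp g T (planarProj x) := by
  have h := partialDeriv_twoHalf_castSucc (isContDiff_V g c) (isContDiff_R g T) 1
  rw [show (Fin.castSucc (1 : Fin 2) : Fin 3) = 1 from rfl] at h
  rw [u, h]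
  refine ⟨?_, ?_, ?_⟩
  · rw [show (0 : Fin 3) = Fin.castSucc (0 : Fin 2) from rfl, twoHalf_apply_castSucc, partialDeriv_V]
    simp
  · rw [show (1 : Fin 3) = Fin.castSucc (1 : Fin 2) from rfl, twoHalf_apply_castSucc, partialDeriv_V]
    simp
  · rw [twoHalf_apply_two, partialDeriv_one_R]

/-- **`∂₂u = 0`.** [ours; elementary] -/
theorem partialDeriv_two_u : Torus.partialDeriv 2 (u g T c) = 0 := by
  rw [show (2 : Fin 3) = Fin.last 2 from rfl, u, partialDeriv_twoHalf_last]

/-- **`|ω(x)|² = c²g'(y₀)² + (1 + g'(y₀)²)T'(ξ)²`** at `y = πx`. [ours; elementary] -/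
theorem torusVorticitySqAt_u (x : 𝕋³) :
    torusVorticitySqAt (u g T c) x =
      c ^ 2 * gp g (planarProj x) ^ 2 + (1 + gp g (planarProj x) ^ 2) * Tp g T (planarProj x) ^ 2 := by
  obtain ⟨h00, h01, h02⟩ := partialDeriv_zero_u g T c x
  obtain ⟨h10, h11, h12⟩ := partialDeriv_one_u g T c x
  have h2 := partialDeriv_two_u g T c
  unfold torusVorticitySqAt
  simp only [Fin.sum_univ_three, h00, h01, h02, h10, h11, h12, h2, Pi.zero_apply, PiLp.zero_apply]
  ring

/-- **`|ω(x)|² ≤ c²G² + (1+G²)Θ²`** when `|g'| ≤ G` and `|T'| ≤ Θ`. [ours; elementary] -/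
theorem torusVorticitySqAt_u_le {G Θ : ℝ} (hG : ∀ t, |deriv g t| ≤ G) (hΘ : ∀ t, |deriv T t| ≤ Θ)
    (x : 𝕋³) : torusVorticitySqAt (u g T c) x ≤ c ^ 2 * G ^ 2 + (1 + G ^ 2) * Θ ^ 2 := by
  rw [torusVorticitySqAt_u]
  have h1 : gp g (planarProj x) ^ 2 ≤ G ^ 2 := by
    have := abs_D_onCircle_le hG (planarProj x 0)
    rw [← sq_abs]; exact pow_le_pow_left₀ (abs_nonneg _) this 2
  have h2 : Tp g T (planarProj x) ^ 2 ≤ Θ ^ 2 := by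
    have := abs_D_onCircle_le hΘ (Φ g (planarProj x) 1)
    rw [Tp, ← sq_abs]; exact pow_le_pow_left₀ (abs_nonneg _) this 2
  have h3 : 0 ≤ Tp g T (planarProj x) ^ 2 := sq_nonneg _
  nlinarith [mul_le_mul h1 h2 h3 (by positivity), sq_nonneg c, mul_le_mul_of_nonneg_left h1 (sq_nonneg c)]

/-- **`∑ᵢ ‖∂ᵢu(x)‖² = c²g'(y₀)² + (1 + g'(y₀)²)T'(ξ)²`** at `y = πx`. [ours; elementary] -/
theorem sum_norm_sq_partialDeriv_u (x : 𝕋³) :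
    ∑ i, ‖Torus.partialDeriv i (u g T c) x‖ ^ 2 =
      c ^ 2 * gp g (planarProj x) ^ 2 + (1 + gp g (planarProj x) ^ 2) * Tp g T (planarProj x) ^ 2 := by
  obtain ⟨h00, h01, h02⟩ := partialDeriv_zero_u g T c x
  obtain ⟨h10, h11, h12⟩ := partialDeriv_one_u g T c x
  have h2 := partialDeriv_two_u g T c
  simp only [Fin.sum_univ_three, EuclideanSpace.norm_sq_eq, Real.norm_eq_abs, sq_abs, h00, h01, h02,
    h10, h11, h12, h2, Pi.zero_apply, PiLp.zero_apply]
  ring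

/-- **The production integrand**: `⟪(u·∇)u, Δu⟫(x) = −c g(y₀)T'(ξ)·(g''(y₀)T'(ξ) + (1+g'(y₀)²)T''(ξ))`
at `y = πx`. [ours; elementary] -/
theorem inner_convect_laplacian_u (x : 𝕋³) :
    ⟪Torus.convect (u g T c) (u g T c) x, Torus.laplacian (u g T c) x⟫_ℝ =
      (-c * g.onCircle (planarProj x 0) * Tp g T (planarProj x)) *
        (gpp g (planarProj x) * Tp g T (planarProj x) +
          (1 + gp g (planarProj x) ^ 2) * Tpp g T (planarProj x)) := by
  rw [u, convect_twoHalf (isContDiff_V g c) (isContDiff_R g T),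
    laplacian_twoHalf (isSmooth_V g c) (isSmooth_R g T), inner_twoHalf, convect_V, Pi.zero_apply,
    inner_zero_left, zero_add, inner_V_gradient_R, laplacian_R]

end ShearComposition

end Summit.NavierStokesRegularity.FunctionalMining

end
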